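import Mathlib
import Literature.Analysis.FluidPDE.Tao2016AveragedNS.ShiftSetCascadeFlows
import Summits.NavierStokesRegularity.NavierStokesRegularity.Theses.TaoLadderRungTwoFlat
import HarnessLib

/-!
# `LocalDynamicsSufficesAtOn` — the local robust checkpoint induction implies Theorem 4.2-level
  blow-up on an arbitrary shift set `𝕊` (item stmt-NavierStokesRegularity-22991, support of route
  TaoLadderRungTwoFlat; the S♭ PORT of the shared support `LocalDynamicsSufficesAt` =
  stmt-NavierStokesRegularity-20426, `Theorems/TaoLadderRungThreeLocalDynamicsSufficesAt.lean`)

HONEST FRAMING: bookkeeping about Tao-type MODEL lattice pseudo-flows (Tao 2016, §6.2: "Theorem 6.2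
⇐ Proposition 6.3", the inductive step abstracted as the cell predicate `DynamicsLocalAtOn 𝕊`).
Nothing here is a statement about the Navier–Stokes equations; the theorem is an implication whose
hypothesis `DynamicsLocalAtOn shiftSetFlat ε₀ R` is an open existence question.

**Statement (`LocalDynamicsSufficesAtOn`, verbatim the route decl).** For `ε₀ > 0` and `R ≥ 1`,
`DynamicsLocalAtOn shiftSetFlat ε₀ R` implies that some `m`, table `α ∈ InTableClassOn shiftSetFlat R`
and datum `X₀` have `NoGlobalCascadeOn shiftSetFlat ε₀ α X₀`.

PROOF = the tree proof of `LocalDynamicsSufficesAt.noGlobalCascade_of_local`, over `𝕊`: the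
contradiction "shell checkpoints at every level versus the a priori bound (4.5)"
(`false_of_shellCheckpoints_on`, a copy of the tree's `CascadeODESolutionFrom.false_of_shellCheckpoints`,
which uses ONLY the (4.5)-field `apriori_X` and the checkpoint bookkeeping `ShellCheckpoints.*`), the
base of the induction at the anchor checkpoint (`init_X`, `init_E` only), the induction along a global
pseudo-solution restricted to finite horizons (`CascadeODESolutionFromOn.restrict`), and forgetting the
epoch description. The tree proof never used (4.11), the one field the `𝕊`-structures lack.
-/

noncomputable section

-- the sub-problem namespace repeats the summit name by design (D-0017)
set_option linter.dupNamespace false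

namespace Summit.NavierStokesRegularity.NavierStokesRegularity.Theorems

open Set Literature.Analysis.FluidPDE Literature.Analysis.FluidPDE.TaoCascade

namespace LocalDynamicsSufficesAtOn

/-! ### Checkpoints at every level contradict (4.5), on `𝕊` -/

section Contradiction

variable {ε₀ θ c : ℝ} {m : ℕ} {i₀ : Fin m} {n₀ : ℤ} {X₀ : Fin m → ℝ}
  {P : (Fin m → ℤ → ℝ) → (Fin m → ℤ → ℝ) → Prop} {X E : Fin m → ℤ → ℝ → ℝ}

/-- **Theorem 6.2 ⇐ Proposition 6.3, for an arbitrary table** (the last paragraph of Tao's §6.2,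
with general ratio exponent `θ < 5/2` and clock constant `c ≥ 0`): if a GLOBAL pseudo-solution admits
shell checkpoints up to every level `N ≥ n₀`, contradiction — the lifespans are summable uniformly
in `N` (`time_le_uniform`) while `(1+(1+ε₀)^{10N}) e_N ≥ |X₀ i₀| (1+ε₀)^{(10-θ)N + θn₀} → ∞`, against
the a priori bound (4.5) on `[0, T₀+1]`. Tao's instance: `θ = 1/10`, `c ≍ 1` (tree:
`TaoODESystem.false_of_blowupCheckpoints`). [cite: Tao2016AveragedNS, §6.2 p. 32 (Thm. 6.2 from Prop. 6.3)] -/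
theorem false_of_shellCheckpoints_on {𝕊 : Finset (ℤ × ℤ × ℤ)}
    {α : Fin m → Fin m → Fin m → ℤ × ℤ × ℤ → ℝ}
    {K₁ K₂ : ℝ} (hε₀ : 0 < ε₀) (hθ : θ < 5 / 2) (hc : 0 ≤ c)
    (hsol : CascadeODESolutionFromOn 𝕊 ε₀ α K₁ K₂ n₀ X₀ X E)
    (hdyn : ∀ N : ℤ, n₀ ≤ N → ∃ t e : ℤ → ℝ, ShellCheckpoints ε₀ θ c i₀ n₀ X₀ P N X E t e) :
    False := by
  have hq0 : (0 : ℝ) < 1 + ε₀ := by linarith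
  have hq1 : (1 : ℝ) < 1 + ε₀ := by linarith
  have hr1 : (1 + ε₀) ^ (θ - 5 / 2) < 1 := Real.rpow_lt_one_of_one_lt_of_neg hq1 (by linarith)
  have h1r : 0 < 1 - (1 + ε₀) ^ (θ - 5 / 2) := by linarith
  -- the datum amplitude is positive (level-`n₀` checkpoints)
  have ha : 0 < |X₀ i₀| := by
    obtain ⟨t, e, h⟩ := hdyn n₀ le_rfl
    rw [← h.e_init]
    exact h.e_pos n₀ le_rfl le_rfl
  -- the uniform time horizon
  set T : ℝ := c * |X₀ i₀|⁻¹ * (1 + ε₀) ^ (-(5 : ℝ) * n₀ / 2) / (1 - (1 + ε₀) ^ (θ - 5 / 2)) + 1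
    with hT
  have hT0 : 0 ≤ c * |X₀ i₀|⁻¹ * (1 + ε₀) ^ (-(5 : ℝ) * n₀ / 2) / (1 - (1 + ε₀) ^ (θ - 5 / 2)) :=
    div_nonneg (by positivity) h1r.le
  have hTpos : 0 < T := by linarith
  obtain ⟨M, hM⟩ := hsol.apriori_X T hTpos
  -- `|X₀ i₀| (1+ε₀)^{(10-θ)N + θ n₀} ≤ M` for every `N ≥ n₀`
  have hbound : ∀ N : ℤ, n₀ ≤ N → |X₀ i₀| * (1 + ε₀) ^ ((10 - θ) * N + θ * n₀) ≤ M := by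
    intro N hN
    obtain ⟨t, e, h⟩ := hdyn N hN
    obtain ⟨ht0, htT⟩ := h.time_le_uniform hε₀ hθ hc hN
    have hMN := hM (t N) ⟨ht0, by linarith⟩ i₀ N
    have hamp := h.amp N hN le_rfl
    have heN := h.rpow_mul_le_amp hε₀ N hN le_rfl
    have hpos10 := Real.rpow_pos_of_pos hq0 ((10 : ℝ) * N)
    calc |X₀ i₀| * (1 + ε₀) ^ ((10 - θ) * N + θ * n₀)
        = (1 + ε₀) ^ ((10 : ℝ) * N) * ((1 + ε₀) ^ (-θ * (N - n₀)) * |X₀ i₀|) := by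
          have hexp : (10 - θ) * (N : ℝ) + θ * n₀ = (10 : ℝ) * N + -θ * (N - n₀) := by ring
          rw [hexp, Real.rpow_add hq0]
          ring
      _ ≤ (1 + (1 + ε₀) ^ ((10 : ℝ) * N)) * e N :=
          mul_le_mul (by linarith) heN (by positivity) (by positivity)
      _ ≤ (1 + (1 + ε₀) ^ ((10 : ℝ) * N)) * |X i₀ N (t N)| :=
          mul_le_mul_of_nonneg_left hamp (by positivity)
      _ ≤ M := hMN
  -- choose `N` with exponent `p = (10-θ)N + θn₀ ≥ 1` and `|X₀ i₀| p ε₀ > M`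
  have h10 : (0 : ℝ) < 10 - θ := by linarith
  have haε : 0 < |X₀ i₀| * ε₀ := mul_pos ha hε₀
  obtain ⟨N, hN⟩ := exists_int_gt
    (max (n₀ : ℝ) ((max 1 (M / (|X₀ i₀| * ε₀) + 1) - θ * n₀) / (10 - θ)))
  have hNn₀ : n₀ ≤ N := by exact_mod_cast ((le_max_left _ _).trans_lt hN).le
  have h2 : max 1 (M / (|X₀ i₀| * ε₀) + 1) < (10 - θ) * N + θ * n₀ := by
    have h2' := (le_max_right _ _).trans_lt hN
    rw [div_lt_iff₀ h10] at h2'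
    linarith
  have hp1 : (1 : ℝ) ≤ (10 - θ) * N + θ * n₀ := ((le_max_left _ _).trans h2.le)
  have hpM : M < |X₀ i₀| * (((10 - θ) * N + θ * n₀) * ε₀) := by
    have h4 : M / (|X₀ i₀| * ε₀) < (10 - θ) * N + θ * n₀ := by
      linarith [le_max_right (1 : ℝ) (M / (|X₀ i₀| * ε₀) + 1)]
    rw [div_lt_iff₀ haε] at h4
    linarith
  -- Bernoulli: `1 + p ε₀ ≤ (1+ε₀)^p`
  have hbern := one_add_mul_self_le_rpow_one_add (s := ε₀) (by linarith) hp1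
  have h5 : |X₀ i₀| * (1 + ((10 - θ) * N + θ * n₀) * ε₀) ≤ M :=
    (mul_le_mul_of_nonneg_left hbern ha.le).trans (hbound N hNn₀)
  have h6 : |X₀ i₀| * (1 + ((10 - θ) * N + θ * n₀) * ε₀) =
      |X₀ i₀| + |X₀ i₀| * (((10 - θ) * N + θ * n₀) * ε₀) := by ring
  linarith


end Contradiction

/-! ### The anchor checkpoint and the induction, on `𝕊` -/

variable {𝕊 : Finset (ℤ × ℤ × ℤ)} {ε₀ θ c : ℝ} {m : ℕ} {i₀ : Fin m}
  {α : Fin m → Fin m → Fin m → ℤ × ℤ × ℤ → ℝ}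
  {K₁ K₂ : ℝ} {n₀ : ℤ} {X₀ : Fin m → ℝ} {P Q : (Fin m → ℤ → ℝ) → (Fin m → ℤ → ℝ) → Prop}
  {X E : Fin m → ℤ → ℝ → ℝ}

/-- The observable datum shell of a local pseudo-solution on `𝕊`: `X_{i,n₀}(0) = X₀ i`.
[cite: Tao2016AveragedNS, §4 (4.7)] -/
theorem X_zero_self_on {T : ℝ} (h : CascadeODESolutionOnShift 𝕊 T ε₀ α K₁ K₂ n₀ X₀ X E) (i : Fin m) :
    X i n₀ 0 = X₀ i := by
  rw [h.init_X, if_pos rfl]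

/-- The rescaled window state of a local pseudo-solution on `𝕊` at the anchor checkpoint
(`t_{n₀} = 0`, `e_{n₀} = |X₀ i₀|`) is the rescaled datum. [cite: Tao2016AveragedNS, §4 (4.7), §6.2 (6.9)–(6.10)] -/
theorem window_zero_on {T : ℝ} (h : CascadeODESolutionOnShift 𝕊 T ε₀ α K₁ K₂ n₀ X₀ X E) (i₀ : Fin m) :
    (fun i k => X i (n₀ + k) 0 / |X₀ i₀|) = datumState i₀ X₀ ∧
      (fun i k => E i (n₀ + k) 0 / |X₀ i₀| ^ 2) = datumEnergy i₀ X₀ := by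
  constructor
  · funext i k
    rw [datumState_apply, h.init_X]
    by_cases hk : k = 0
    · rw [if_pos hk, if_pos (by rw [hk, add_zero])]
    · rw [if_neg hk, if_neg (by intro h'; exact hk (by omega))]
  · funext i k
    rw [datumEnergy_apply, h.init_E, h.init_X]
    by_cases hk : k = 0
    · rw [if_pos hk, if_pos (by rw [hk, add_zero])]
    · rw [if_neg hk, if_neg (by intro h'; exact hk (by omega))]
      ring

/-- **Base of the induction**: along a local pseudo-solution whose rescaled datum satisfies the
transition-state description `P`, the constant sequences `t ≡ 0`, `e ≡ |X₀ i₀|` are epoch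
checkpoints up to the datum level `n₀` (anchor (6.9)–(6.10); no epochs yet).
[cite: Tao2016AveragedNS, §6.2 (6.9)–(6.10) ("we initialise t_{n₀} := 0 and e_{n₀} := 1")] -/
theorem epochCheckpoints_init {T : ℝ} (hsol : CascadeODESolutionOnShift 𝕊 T ε₀ α K₁ K₂ n₀ X₀ X E)
    (hX₀ : X₀ i₀ ≠ 0) (hP : P (datumState i₀ X₀) (datumEnergy i₀ X₀)) :
    EpochCheckpoints ε₀ θ c i₀ n₀ X₀ P Q n₀ X E (fun _ => 0) (fun _ => |X₀ i₀|) where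
  t_init := rfl
  e_init := rfl
  e_pos n _ _ := abs_pos.mpr hX₀
  amp n hn hnN := by
    obtain rfl : n = n₀ := le_antisymm hnN hn
    rw [X_zero_self_on hsol]
  state n hn hnN := by
    obtain rfl : n = n₀ := le_antisymm hnN hn
    obtain ⟨h1, h2⟩ := window_zero_on hsol i₀
    rw [h1, h2]
    exact hP
  mono n hn hnN := absurd hnN (not_le.mpr hn)
  life n hn hnN := absurd hnN (not_le.mpr hn)
  ratio n hn hnN := absurd hnN (not_le.mpr hn)
  epoch n hn hnN := absurd hnN (not_le.mpr hn)

/-- **The induction**: if along a GLOBAL pseudo-solution every run of epoch checkpoints up to a level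
`N ≥ n₀` extends to level `N+1` as soon as the next lifespan fits inside a horizon on which the
solution is a local pseudo-solution (it always does: restrict the global solution to
`[0, t_N + c(1+ε₀)^{-5N/2}/e_N]`), then epoch checkpoints exist at every level.
[cite: Tao2016AveragedNS, §6.2 p. 32 (Prop. 6.3 by induction on N from Prop. 6.4)] -/
theorem forall_exists_epochCheckpoints (hε₀ : 0 < ε₀) (hc : 0 < c)
    (hsol : CascadeODESolutionFromOn 𝕊 ε₀ α K₁ K₂ n₀ X₀ X E) (hX₀ : X₀ i₀ ≠ 0)
    (hP : P (datumState i₀ X₀) (datumEnergy i₀ X₀))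
    (hstep : ∀ T : ℝ, 0 < T → CascadeODESolutionOnShift 𝕊 T ε₀ α K₁ K₂ n₀ X₀ X E →
      ∀ N : ℤ, n₀ ≤ N → ∀ t e : ℤ → ℝ, EpochCheckpoints ε₀ θ c i₀ n₀ X₀ P Q N X E t e →
        t N + c * (1 + ε₀) ^ (-(5 : ℝ) * N / 2) * (e N)⁻¹ ≤ T →
          ∃ s a : ℝ, EpochCheckpoints ε₀ θ c i₀ n₀ X₀ P Q (N + 1) X E
            (Function.update t (N + 1) s) (Function.update e (N + 1) a)) :
    ∀ N : ℤ, n₀ ≤ N → ∃ t e : ℤ → ℝ, EpochCheckpoints ε₀ θ c i₀ n₀ X₀ P Q N X E t e := by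
  intro N hN
  obtain ⟨k, rfl⟩ : ∃ k : ℕ, N = n₀ + k := ⟨(N - n₀).toNat, by omega⟩
  induction k with
  | zero =>
      refine ⟨fun _ => 0, fun _ => |X₀ i₀|, ?_⟩
      simpa using epochCheckpoints_init (θ := θ) (c := c) (Q := Q) (hsol.restrict one_pos) hX₀ hP
  | succ k ih =>
      obtain ⟨t, e, h⟩ := ih (by omega)
      have hq : (0 : ℝ) < 1 + ε₀ := by linarith
      have heN : 0 < e (n₀ + k) := h.e_pos (n₀ + k) (by omega) le_rfl
      have htN : 0 ≤ t (n₀ + k) := h.t_nonneg (n₀ + k) (by omega) le_rfl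
      set T : ℝ := t (n₀ + k) + c * (1 + ε₀) ^ (-(5 : ℝ) * ((n₀ + k : ℤ) : ℝ) / 2) * (e (n₀ + k))⁻¹
        with hT
      have hTpos : 0 < T := by
        have : 0 < c * (1 + ε₀) ^ (-(5 : ℝ) * ((n₀ + k : ℤ) : ℝ) / 2) * (e (n₀ + k))⁻¹ :=
          mul_pos (mul_pos hc (Real.rpow_pos_of_pos hq _)) (inv_pos.mpr heN)
        linarith
      obtain ⟨s, a, h'⟩ := hstep T hTpos (hsol.restrict hTpos) (n₀ + k) (by omega) t e h le_rfl
      have hidx : n₀ + ((k + 1 : ℕ) : ℤ) = n₀ + (k : ℤ) + 1 := by push_cast; ring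
      rw [hidx]
      exact ⟨_, _, h'⟩

/-- **`LocalDynamicsSufficesAt`, main lemma** (general number of modes): `DynamicsLocalAt`-shaped
data — base clause at the rescaled datum and the local (step) clause with threshold `N₀(K₁, K₂)` —
give `NoGlobalCascadeOn 𝕊 ε₀ α X₀`. [cite: Tao2016AveragedNS, §6.2 p. 32 (Thm. 6.2 from Props. 6.3–6.4) with §6.1 p. 31] -/
theorem noGlobalCascadeOn_of_local (hε₀ : 0 < ε₀) (hθ : θ < 5 / 2) (hc : 0 < c) (hX₀ : X₀ i₀ ≠ 0)
    (hP : P (datumState i₀ X₀) (datumEnergy i₀ X₀))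
    (hstep : ∀ K₁ K₂ : ℝ, 0 ≤ K₁ → 0 ≤ K₂ → ∃ N₀ : ℤ, ∀ n₀ : ℤ, N₀ ≤ n₀ →
      ∀ T : ℝ, 0 < T → ∀ X E : Fin m → ℤ → ℝ → ℝ,
        CascadeODESolutionOnShift 𝕊 T ε₀ α K₁ K₂ n₀ X₀ X E →
          ∀ N : ℤ, n₀ ≤ N → ∀ t e : ℤ → ℝ, EpochCheckpoints ε₀ θ c i₀ n₀ X₀ P Q N X E t e →
            t N + c * (1 + ε₀) ^ (-(5 : ℝ) * N / 2) * (e N)⁻¹ ≤ T →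
              ∃ s a : ℝ, EpochCheckpoints ε₀ θ c i₀ n₀ X₀ P Q (N + 1) X E
                (Function.update t (N + 1) s) (Function.update e (N + 1) a)) :
    NoGlobalCascadeOn 𝕊 ε₀ α X₀ := by
  intro K₁ K₂ hK₁ hK₂
  obtain ⟨N₀, hN₀⟩ := hstep K₁ K₂ hK₁ hK₂
  refine ⟨N₀, fun n₀ hn₀ => ?_⟩
  rintro ⟨X, E, hsol⟩
  refine false_of_shellCheckpoints_on (i₀ := i₀) (P := P) hε₀ hθ hc.le hsol fun N hN => ?_
  obtain ⟨t, e, h⟩ := forall_exists_epochCheckpoints (Q := Q) hε₀ hc hsol hX₀ hP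
    (fun T hT hloc N hN t e h hfit => hN₀ n₀ hn₀ T hT X E hloc N hN t e h hfit) N hN
  exact ⟨t, e, h.forget⟩


end LocalDynamicsSufficesAtOn

open LocalDynamicsSufficesAtOn in
/-- **Item stmt-NavierStokesRegularity-22991** (`TaoLadderRungTwoFlat.LocalDynamicsSufficesAtOn`): for
`ε₀ > 0` and `R ≥ 1`, `DynamicsLocalAtOn shiftSetFlat ε₀ R` gives `m`, a table
`α ∈ InTableClassOn shiftSetFlat R` and a datum `X₀` with `NoGlobalCascadeOn shiftSetFlat ε₀ α X₀`
(the table and datum of `DynamicsLocalAtOn` itself). [cite: Tao2016AveragedNS, §6.2 p. 32 with §6.1 p. 31] -/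
theorem taoLadderRungTwoFlat_localDynamicsSufficesAtOn_proof :
    Summit.NavierStokesRegularity.NavierStokesRegularity.Theses.TaoLadderRungTwoFlat.LocalDynamicsSufficesAtOn := by
  unfold
    Summit.NavierStokesRegularity.NavierStokesRegularity.Theses.TaoLadderRungTwoFlat.LocalDynamicsSufficesAtOn
  intro ε₀ R hε₀ _hR hdyn
  obtain ⟨m, θ, c, i₀, α, X₀, P, Q, _hθ0, hθ, hc, hα, hX₀, hP, hstep⟩ := hdyn
  exact ⟨m, α, X₀, hα, noGlobalCascadeOn_of_local (Q := Q) hε₀ hθ hc hX₀ hP hstep⟩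

end Summit.NavierStokesRegularity.NavierStokesRegularity.Theorems

end
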